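import Summits.ResolutionOfSingularities.ResolutionOfSingularities.Theorems.MarkedTransferCampaignW12SandwichTSharpNoUnitProof
import Literature.AlgebraicGeometry.Resolution.HasseSchmidtDerivatives
import Mathlib.RingTheory.MvPolynomial.Expand
import Mathlib.RingTheory.MvPolynomial.Ideal
import Mathlib.RingTheory.MvPolynomial.Basic
import Mathlib.Data.ZMod.Basic
import HarnessLib

/-!
# [OURS · L1 W1.2] The BOX CRITERION for the Frobenius-sandwich negative modules at a point of affine space:
# box Hasse derivatives are sandwich operators, and the exact dichotomy
# «`℘nega_sw(E,−a) ⊆ 𝔪` for all `a` ⟺ `℘(E,dm) ⊆ 𝔪^{[p^e]}` for all `d ≥ 1`» (seat res-L1-s12-pv-1)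

LADDER-RESOLUTION rung L (rescue), cell `res-hironaka`, RESCUE-SEED §1 slot **W1.2**; companion of
`MarkedTransferCampaignW12SandwichFrobeniusConstants.lean` (p467195: Frobenius-extended ideals are sandwich-stable ⇒
the no-unit criterion) and `MarkedTransferCampaignW12SandwichTSharpNoUnitProof.lean` (p468852: the campaign Props of
the typed vocabulary v2 p468441 hold). Those give the SUFFICIENT condition for «no unit»; this file supplies the
operators that make it NECESSARY on affine space, i.e. the general form of kill test K1.2's registered schema
(res-L1-k12, HOME/STATUS.md 2026-08-26T19:41:04Z: «box criterion … Conversely a box monomial `x^γ` (`|γ| ≤ dm+a`) with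
nonzero coefficient in some `f ∈ ℘(E,dm)` plus the operator `∂^{(γ)}` (order `|γ|`) gives a unit at `ξ`»). Ring level:
`A = R[x_i : i ∈ σ]` (`MvPolynomial σ R`) over ANY commutative ring `R` of characteristic `p`, the point `ξ` = the origin,
`𝔪 = 𝔪_ξ ∩ A = idealOfVars` (localising at `ξ` changes neither «`⊆ 𝔪`» nor «`= (1)` after inverting `A ∖ 𝔪`»).

## What is proved (sorry-free)

* §1 `hasseDeriv_pow_mul_of_lt`: for a BOX multi-index `γ` (`γ_i < p^e` for all `i`) the Hasse–Schmidt derivative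
  `∂^{(γ)}` (tree `Resolution.hasseDeriv`) is `ρ^e(A)`-linear: `∂^{(γ)}(f^{p^e}·g) = f^{p^e}·∂^{(γ)} g` (Taylor morphism +
  `(F)^{p^e} = ρ^e(expand F)`, Mathlib `MvPolynomial.map_iterateFrobenius_expand`; Lucas in disguise). Hence
  (`exists_sandwichOp_hasseDeriv`) it IS a sandwich operator: an `ρ^e(A)`-linear endomorphism of Grothendieck order
  `≤ |γ|` relative to `ρ^e(A)` (order transfer `isDiffOpLE_of_apply_eq`). This is the lane-B reading recorded in v2
  («an absolute operator of order `< p^e` is already `ρ^e(O)`-linear») made precise: box SHAPE, not order, decides.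
* §2 `not_sandwichPNega_le_idealOfVars`: `f ∈ ℘(E,dm)` (`dm ≠ 0`) with a box monomial `x^γ`, `|γ| ≤ dm + a`, `a ≤ dm`,
  of nonzero coefficient ⇒ `℘nega_sw(E,−a) ⊄ 𝔪` (via p467195's `W12.not_sandwichPNega_le` and the tree's
  `constantCoeff_hasseDeriv`: `(∂^{(γ)} f)(0) = coeff_γ f`).
* §3 `map_iterateFrobenius_idealOfVars` (`𝔪^{[p^e]} = (x_i^{p^e})_i`), `exists_box_of_not_mem` (an element outside
  `(x_i^{p^e})_i` has a box monomial), `degree_le_card_mul_of_box` (`|γ| ≤ n·(p^e − 1)`).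
* §4 THE DICHOTOMY `sandwichPNega_le_idealOfVars_iff`: if `n·(p^e − 1) ≤ 2m`, `m ≠ 0` (`n = |σ|`), then
  `(∀ a, ℘nega_sw(E,−a) ⊆ 𝔪) ↔ (∀ d ≥ 1, ℘(E,dm) ⊆ 𝔪^{[p^e]})`; under Th-4.5-shaped monotonicity the right side is
  `℘(E,m) ⊆ 𝔪^{[p^e]}` (`…_iff_of_mono`). K1.2's parameters (`p = 2`, `e = 1`, `m = q = 2`, `n ≤ 4`) satisfy the side
  condition (`dichotomy_K12_fin3`, `dichotomy_K12_fin2`): for each recorded witness the kill-test question IS the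
  membership `℘(E,2d)_ξ ⊆ 𝔪_ξ^{[2]}`, nothing more and nothing less — which witnesses pass is res-L1-k12's certificate and
  is NOT asserted here.

HONEST FRAMING. OURS statements about OUR objects (`Campaign.sandwichPNega` = row 008's Def 5.1 carrier re-based on
`ρ^e`); Def 5.1 / Eq. (36) (p.25 L31–L44) is a CANDIDATE [claim: Hironaka2017, status: under-review] entering only
through the typed carrier and hypotheses on an abstract family `P` («`P j = ℘(E,j)`»). No verdict on GAP rows
R01/R04/R05/R08 is implied; nothing here is a statement of the manuscript or progress on resolution of singularities in
positive characteristic. BARRIER LINE as in p467195 (`FrobeniusTwistResolution.not_hasResolution_Spec_frobTwist`):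
ideal-membership facts in `A` only; nothing transports across `ρ^e(A) ⊂ A`. AI proof is weaker than expert review.
-/

noncomputable section

set_option linter.dupNamespace false -- mandated namespace of this single-conjunct summit

namespace Summit.ResolutionOfSingularities.ResolutionOfSingularities.Theorems.Campaign.W12

open MvPolynomial
open Literature.AlgebraicGeometry.Resolution
open Literature.AlgebraicGeometry.Hironaka2017
open Summit.ResolutionOfSingularities.ResolutionOfSingularities.Theorems.Campaign

universe u w

/-! ## §0 Order transfer across scalar rings -/

/-- Grothendieck order is a property of the underlying FUNCTION: if an `S`-linear and an `S'`-linear endomorphism of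
`A` agree pointwise, they have the same order (the commutators `[D, a]` agree pointwise, induction on `n`). Used to
move the tree's `isDiffOpLE_hasseDeriv` (relative to `R`) to the sandwich base `ρ^e(A)`. [folklore] -/
theorem isDiffOpLE_of_apply_eq {S S' A : Type*} [CommSemiring S] [CommSemiring S'] [CommRing A] [Algebra S A]
    [Algebra S' A] : ∀ (n : ℕ) {D : A →ₗ[S] A} {D' : A →ₗ[S'] A},
      IsDiffOpLE S n D → (∀ x, D' x = D x) → IsDiffOpLE S' n D'
  | 0, D, D', hD, h => fun a => by
    ext t
    have := LinearMap.congr_fun (hD a) t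
    rw [commMul_apply, LinearMap.zero_apply] at this ⊢
    rw [h, h, this]
  | n + 1, D, D', hD, h => fun a =>
    isDiffOpLE_of_apply_eq n (hD a) (fun x => by rw [commMul_apply, commMul_apply, h, h])

/-! ## §1 Box Hasse derivatives are sandwich operators -/

section Box

variable {σ : Type u} {R : Type w} [CommRing R] (p : ℕ) [Fact p.Prime] [CharP R p]

/-- The Taylor morphism fixes constant terms in `u`: `(taylor f)(x, u = 0) = f`. [folklore] -/
theorem constantCoeff_taylor (f : MvPolynomial σ R) : constantCoeff (taylor R f) = f := by
  have h := RingHom.congr_fun (constantCoeff_comp_taylor R (σ := σ)) f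
  rwa [RingHom.comp_apply, RingHom.id_apply] at h

/-- **Box Hasse derivatives are `ρ^e`-linear.** For a box multi-index `γ` (`γ_i < p^e` for every `i`) and all
`f g ∈ R[x]` (`R` of characteristic `p`): `∂^{(γ)}(f^{p^e}·g) = f^{p^e}·∂^{(γ)}(g)`. Proof: `∂^{(γ)}` reads the
`u^γ`-coefficient of the Taylor expansion; `taylor(f)^{p^e} = ρ^e(expand_{p^e}(taylor f))` has only monomials `u^{p^e β}`,
and `p^e β ≤ γ` forces `β = 0`. [folklore] -/
theorem hasseDeriv_pow_mul_of_lt (e : ℕ) {γ : σ →₀ ℕ} (hγ : ∀ i, γ i < p ^ e) (f g : MvPolynomial σ R) :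
    hasseDeriv R γ (f ^ p ^ e * g) = f ^ p ^ e * hasseDeriv R γ g := by
  classical
  rw [hasseDeriv_apply, hasseDeriv_apply, map_mul, map_pow, coeff_mul]
  rw [Finset.sum_eq_single (0, γ)]
  · change constantCoeff (taylor R f ^ p ^ e) * coeff γ (taylor R g) = _
    rw [map_pow, constantCoeff_taylor]
  · rintro ⟨β, δ⟩ hβδ hne
    have hsum : β + δ = γ := Finset.mem_antidiagonal.mp hβδ
    have hβ0 : β ≠ 0 := by
      rintro rfl
      exact hne (by rw [zero_add] at hsum; rw [hsum])
    obtain ⟨i, hi⟩ : ∃ i, β i ≠ 0 := by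
      by_contra h
      exact hβ0 (Finsupp.ext fun i => not_not.mp fun hi => h ⟨i, hi⟩)
    have hlt : β i < p ^ e := by
      have : β i ≤ γ i := by rw [← hsum]; exact Nat.le_add_right _ _
      exact lt_of_le_of_lt this (hγ i)
    have hndvd : ¬ p ^ e ∣ β i := Nat.not_dvd_of_pos_of_lt (Nat.pos_of_ne_zero hi) hlt
    rw [← map_iterateFrobenius_expand p (taylor R f) e, coeff_map, coeff_expand_of_not_dvd _ hndvd, map_zero,
      zero_mul]
  · intro h
    exact absurd (Finset.mem_antidiagonal.mpr (zero_add γ)) h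

/-- **Box Hasse derivatives ARE sandwich operators**: for a box `γ` there is an `ρ^e(A)`-LINEAR endomorphism of
`A = R[x]` of Grothendieck order `≤ |γ|` RELATIVE TO `ρ^e(A)` which is `∂^{(γ)}` as a function — so `∂^{(γ)} f` lies in
every `Diff^{(k)}_{A/ρ^e(A)}·I` with `f ∈ I`, `|γ| ≤ k` (the operators of the typed `Campaign.sandwichDD`). [folklore] -/
theorem exists_sandwichOp_hasseDeriv [DecidableEq σ] (e : ℕ) {γ : σ →₀ ℕ} (hγ : ∀ i, γ i < p ^ e) :
    ∃ D : MvPolynomial σ R →ₗ[↥(iterateFrobenius (MvPolynomial σ R) p e).range] MvPolynomial σ R,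
      IsDiffOpLE (↥(iterateFrobenius (MvPolynomial σ R) p e).range) γ.degree D ∧
        ∀ f, D f = hasseDeriv R γ f := by
  refine ⟨{ toFun := hasseDeriv R γ, map_add' := map_add _, map_smul' := ?_ }, ?_, fun f => rfl⟩
  · rintro ⟨_, g, rfl⟩ f
    change hasseDeriv R γ (iterateFrobenius (MvPolynomial σ R) p e g * f) =
      iterateFrobenius (MvPolynomial σ R) p e g * hasseDeriv R γ f
    rw [iterateFrobenius_def]
    exact hasseDeriv_pow_mul_of_lt p e hγ g f
  · exact isDiffOpLE_of_apply_eq _ (isDiffOpLE_hasseDeriv R γ.degree γ le_rfl) fun _ => rfl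

/-! ## §2 Sharpness at the origin: a box monomial of low degree in `℘(E,dm)` defeats «`⊆ 𝔪`» -/

/-- **Box monomials manufacture non-vanishing at the origin.** If `f ∈ ℘(E,dm)` (`dm ≠ 0`) carries a box monomial
`x^γ` (`γ_i < p^e`) of degree `|γ| ≤ dm + a`, `a ≤ dm`, with coefficient `coeff_γ f ≠ 0`, then the sandwich negative
module `℘nega_sw(E,−a)` is NOT contained in `𝔪 = (x_i)_i`: it contains `∂^{(γ)} f`, whose constant term is `coeff_γ f`.
(Over a field `R` and after localising at the origin this is a UNIT, i.e. the K1.2 DEAD-certificate shape.) [folklore] -/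
theorem not_sandwichPNega_le_idealOfVars [DecidableEq σ] (e : ℕ) (P : ℕ → Ideal (MvPolynomial σ R)) (m a d : ℕ)
    (had : a ≤ d * m) (hdm : d * m ≠ 0) {γ : σ →₀ ℕ} (hγ : ∀ i, γ i < p ^ e) (hdeg : γ.degree ≤ d * m + a)
    {f : MvPolynomial σ R} (hf : f ∈ P (d * m)) (hc : coeff γ f ≠ 0) :
    ¬ sandwichPNega p e P m a ≤ idealOfVars σ R := by
  obtain ⟨D, hD, hDf⟩ := exists_sandwichOp_hasseDeriv (R := R) p e hγ
  have hDf' : D f ∉ idealOfVars σ R := by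
    intro hmem
    apply hc
    rw [← constantCoeff_hasseDeriv R γ f, ← hDf f]
    exact coeff_zero_eq_zero_of_mem_idealOfVars R hmem
  exact not_sandwichPNega_le (O := MvPolynomial σ R) p e P m a d had hdm (hD.of_le hdeg) hf (idealOfVars σ R) hDf'

/-! ## §3 The box ideal `𝔪^{[p^e]} = (x_i^{p^e})_i` and box monomials -/

/-- `𝔪^{[p^e]} = 𝔪.map ρ^e = (x_i^{p^e} : i ∈ σ)`. [folklore] -/
theorem map_iterateFrobenius_idealOfVars (e : ℕ) :
    (idealOfVars σ R).map (iterateFrobenius (MvPolynomial σ R) p e) =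
      Ideal.span (Set.range fun i : σ => (X i : MvPolynomial σ R) ^ p ^ e) := by
  unfold idealOfVars
  rw [Ideal.map_span, ← Set.range_comp]
  simp only [Function.comp_def, iterateFrobenius_def]

omit [Fact p.Prime] [CharP R p] in
/-- The box ideal as a monomial ideal: `(x_i^{p^e})_i = span {monomial (p^e·e_i) 1}`. [folklore] -/
theorem span_X_pow_eq_span_monomial (e : ℕ) :
    Ideal.span (Set.range fun i : σ => (X i : MvPolynomial σ R) ^ p ^ e) =
      Ideal.span ((fun s => monomial s (1 : R)) '' Set.range fun i : σ => Finsupp.single i (p ^ e)) := by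
  congr 1
  ext f
  simp only [Set.mem_range, Set.mem_image, exists_exists_eq_and, X_pow_eq_monomial]

omit [Fact p.Prime] [CharP R p] in
/-- **An element outside the box ideal has a box monomial**: `f ∉ (x_i^{p^e})_i` ⇒ some monomial `x^γ` of `f`
(`coeff_γ f ≠ 0`) has all exponents `γ_i < p^e`. [folklore] -/
theorem exists_box_of_not_mem (e : ℕ) {f : MvPolynomial σ R}
    (hf : f ∉ Ideal.span (Set.range fun i : σ => (X i : MvPolynomial σ R) ^ p ^ e)) :
    ∃ γ : σ →₀ ℕ, coeff γ f ≠ 0 ∧ ∀ i, γ i < p ^ e := by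
  rw [span_X_pow_eq_span_monomial, mem_ideal_span_monomial_image] at hf
  push Not at hf
  obtain ⟨γ, hγ, hbox⟩ := hf
  refine ⟨γ, mem_support_iff.mp hγ, fun i => ?_⟩
  by_contra h
  exact hbox (Finsupp.single i (p ^ e)) ⟨i, rfl⟩ (Finsupp.single_le_iff.mpr (not_lt.mp h))

omit [Fact p.Prime] [CharP R p] in
/-- Conversely an element of the box ideal has no box monomial. [folklore] -/
theorem coeff_eq_zero_of_mem_of_box (e : ℕ) {f : MvPolynomial σ R}
    (hf : f ∈ Ideal.span (Set.range fun i : σ => (X i : MvPolynomial σ R) ^ p ^ e)) {γ : σ →₀ ℕ}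
    (hγ : ∀ i, γ i < p ^ e) : coeff γ f = 0 := by
  rw [span_X_pow_eq_span_monomial, mem_ideal_span_monomial_image] at hf
  by_contra h
  obtain ⟨_, ⟨i, rfl⟩, hle⟩ := hf γ (mem_support_iff.mpr h)
  exact absurd (Finsupp.single_le_iff.mp hle) (not_le.mpr (hγ i))

omit [Fact p.Prime] in
/-- A box multi-index in `n = |σ|` variables has degree `|γ| ≤ n·(p^e − 1)`. [folklore] -/
theorem degree_le_card_mul_of_box [Fintype σ] (e : ℕ) {γ : σ →₀ ℕ} (hγ : ∀ i, γ i < p ^ e) :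
    γ.degree ≤ Fintype.card σ * (p ^ e - 1) := by
  rw [Finsupp.degree_eq_sum]
  calc ∑ i, γ i ≤ ∑ _i : σ, (p ^ e - 1) := Finset.sum_le_sum fun i _ => Nat.le_sub_one_of_lt (hγ i)
    _ = Fintype.card σ * (p ^ e - 1) := by rw [Finset.sum_const, smul_eq_mul, Finset.card_univ]

/-! ## §4 The dichotomy -/

/-- Sufficiency restated at the origin (from p468852's `W12.sandwichPNega_le_span_of_mul`): `m ≠ 0` and
`℘(E,dm) ⊆ 𝔪^{[p^e]}` for all `d ≥ 1` ⇒ every `℘nega_sw(E,−a) ⊆ 𝔪^{[p^e]} ⊆ 𝔪`. [folklore] -/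
theorem sandwichPNega_le_idealOfVars_of_box (e : ℕ) (P : ℕ → Ideal (MvPolynomial σ R)) {m : ℕ} (hm0 : m ≠ 0)
    (hP : ∀ d, 0 < d → P (d * m) ≤ (idealOfVars σ R).map (iterateFrobenius (MvPolynomial σ R) p e)) (a : ℕ) :
    sandwichPNega p e P m a ≤ (idealOfVars σ R).map (iterateFrobenius (MvPolynomial σ R) p e) ∧
      sandwichPNega p e P m a ≤ idealOfVars σ R := by
  have h : sandwichPNega p e P m a ≤ (idealOfVars σ R).map (iterateFrobenius (MvPolynomial σ R) p e) := by
    refine sandwichPNega_le_span_of_mul p e (image_subset_range_iterateFrobenius e _) (fun d hd => ?_) a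
    have hdm : d * m ≠ 0 := Nat.mul_ne_zero (Nat.pos_iff_ne_zero.mp hd) hm0
    rw [S05NegativePart.pPosi, if_neg hdm]
    exact hP d hd
  exact ⟨h, h.trans (map_iterateFrobenius_le e _)⟩

/-- **THE BOX CRITERION (dichotomy at the origin of `𝔸ⁿ`).** `A = R[x_1,…,x_n]`, `R` of characteristic `p`, `m ≠ 0`,
and the side condition `n·(p^e − 1) ≤ 2m` (every box monomial has degree `≤ 2m ≤ dm + dm`, so the summand `d` of
Eq. (36) with `a = dm` reaches it). Then for every family `P` («`P j = ℘(E,j)`»):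
`(∀ a, ℘nega_sw(E,−a) ⊆ 𝔪) ↔ (∀ d ≥ 1, ℘(E,dm) ⊆ 𝔪^{[p^e]})`.
`⇐` is the structural no-unit criterion (p467195/p468852); `⇒`: an `f ∈ ℘(E,dm)` outside the box ideal has a box
monomial `x^γ`, `|γ| ≤ 2dm`, and `∂^{(γ)}` is a sandwich operator of order `≤ dm + dm` with `(∂^{(γ)} f)(0) ≠ 0`.
[folklore] -/
theorem sandwichPNega_le_idealOfVars_iff [Fintype σ] [DecidableEq σ] (e : ℕ) {m : ℕ} (hm0 : m ≠ 0)
    (hm : Fintype.card σ * (p ^ e - 1) ≤ 2 * m) (P : ℕ → Ideal (MvPolynomial σ R)) :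
    (∀ a, sandwichPNega p e P m a ≤ idealOfVars σ R) ↔
      ∀ d, 0 < d → P (d * m) ≤ (idealOfVars σ R).map (iterateFrobenius (MvPolynomial σ R) p e) := by
  constructor
  · intro h d hd
    by_contra hP
    obtain ⟨f, hf, hfnot⟩ := Set.not_subset.mp hP
    rw [map_iterateFrobenius_idealOfVars] at hfnot
    obtain ⟨γ, hc, hγ⟩ := exists_box_of_not_mem p e hfnot
    have hdeg : γ.degree ≤ d * m + d * m :=
      (degree_le_card_mul_of_box p e hγ).trans (by nlinarith)
    have hdm : d * m ≠ 0 := Nat.mul_ne_zero (Nat.pos_iff_ne_zero.mp hd) hm0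
    exact not_sandwichPNega_le_idealOfVars p e P m (d * m) d le_rfl hdm hγ hdeg hf hc (h (d * m))
  · intro h a
    exact (sandwichPNega_le_idealOfVars_of_box p e P hm0 h a).2

/-- Under Th-4.5-shaped monotonicity `℘(E,a) ⊆ ℘(E,c)` (`c ≤ a`) the criterion reads on the single piece `℘(E,m)`:
`(∀ a, ℘nega_sw(E,−a) ⊆ 𝔪) ↔ ℘(E,m) ⊆ 𝔪^{[p^e]}`. [folklore] -/
theorem sandwichPNega_le_idealOfVars_iff_of_mono [Fintype σ] [DecidableEq σ] (e : ℕ) {m : ℕ} (hm0 : m ≠ 0)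
    (hm : Fintype.card σ * (p ^ e - 1) ≤ 2 * m) (P : ℕ → Ideal (MvPolynomial σ R))
    (hmono : ∀ a c : ℕ, c ≤ a → P a ≤ P c) :
    (∀ a, sandwichPNega p e P m a ≤ idealOfVars σ R) ↔
      P m ≤ (idealOfVars σ R).map (iterateFrobenius (MvPolynomial σ R) p e) := by
  rw [sandwichPNega_le_idealOfVars_iff p e hm0 hm P]
  constructor
  · intro h
    simpa using h 1 one_pos
  · intro h d hd
    exact (hmono (d * m) m (Nat.le_mul_of_pos_left m hd)).trans h

end Box

/-! ## §5 K1.2's parameters: `p = 2`, `e = 1`, `m = q = 2`, `n ≤ 4` -/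

/-- **K1.2 dichotomy, three variables** (witnesses W1 = `(y²+xw², 2)`, W2 = `((y²+yω₁⁵ω₂+yω₁ω₂+ω₁⁴), 2)` of the
register live in `𝔽₂[x,y,w]` / `𝔽₂[y,ω₁,ω₂]`; `3·(2−1) ≤ 2·2`): for EVERY family `P` over `𝔽₂[X_0,X_1,X_2]`,
`(∀ a, ℘nega_sw(E,−a) ⊆ 𝔪₀) ↔ (∀ d ≥ 1, ℘(E,2d) ⊆ 𝔪₀^{[2]} = (X_0²,X_1²,X_2²))`. Which side a given witness is on is
res-L1-k12's certificate; not asserted here. [folklore] -/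
theorem dichotomy_K12_fin3 (P : ℕ → Ideal (MvPolynomial (Fin 3) (ZMod 2))) :
    (∀ a, sandwichPNega 2 1 P 2 a ≤ idealOfVars (Fin 3) (ZMod 2)) ↔
      ∀ d, 0 < d → P (d * 2) ≤
        (idealOfVars (Fin 3) (ZMod 2)).map (iterateFrobenius (MvPolynomial (Fin 3) (ZMod 2)) 2 1) :=
  sandwichPNega_le_idealOfVars_iff 2 1 two_ne_zero (by simp) P

/-- **K1.2 dichotomy, two variables** (witness W3 = `((y²+yx⁴+yx²+x⁴), 2)` in `𝔽₂[x,y]`; `2·(2−1) ≤ 2·2`).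
[folklore] -/
theorem dichotomy_K12_fin2 (P : ℕ → Ideal (MvPolynomial (Fin 2) (ZMod 2))) :
    (∀ a, sandwichPNega 2 1 P 2 a ≤ idealOfVars (Fin 2) (ZMod 2)) ↔
      ∀ d, 0 < d → P (d * 2) ≤
        (idealOfVars (Fin 2) (ZMod 2)).map (iterateFrobenius (MvPolynomial (Fin 2) (ZMod 2)) 2 1) :=
  sandwichPNega_le_idealOfVars_iff 2 1 two_ne_zero (by simp) P

end Summit.ResolutionOfSingularities.ResolutionOfSingularities.Theorems.Campaign.W12

end
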